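import Literature.NumberTheory.EllipticCurves.Kato2004.IwasawaCohomologyNumberField
import Literature.NumberTheory.EllipticCurves.Kato2004.IwasawaCohomologyUniqueProofs
import Literature.NumberTheory.EllipticCurves.Kato2004.LocalIwasawaCohomology
import Literature.NumberTheory.EllipticCurves.TateModuleBaseChange
import Literature.NumberTheory.EllipticCurves.ZpExtensionRestrict
import Literature.NumberTheory.GaloisRepresentations.AbsIntegersEquiv
import Literature.NumberTheory.EllipticCurves.BSDConductorProofs
import HarnessLib

/-!
# The SHAPIRO RESTRICTION `res : 𝐇¹_Γ(T_pW) → 𝐇¹_{K,Γ}(T_pW_K)` from Kato's Iwasawa cohomology over `ℚ` to the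
# Iwasawa cohomology over a number field `K` along `Γ_K → Γ_ℚ` (`K_∞ = K·ℚ_∞`), built levelwise on the pinned carriers

Topic `NumberTheory/EllipticCurves`, sub-directory `Kato2004`; companion of `IwasawaCohomologyNumberField.lean` (the
`K`-carrier `IwasawaH1DataOver`) and of `LocalIwasawaCohomology.lean` §4 (the localisation `IwasawaH1Data.loc`, whose
construction this file repeats word for word with `Γ_{ℚ_v} → Γ_ℚ` replaced by `Γ_K → Γ_ℚ` and the identity on
coefficients replaced by the base-change isomorphism `T_pW ≅ T_p(W_K)`, `tateModuleEquiv`).  Seat `bsd-2adic-conv-1`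
GEN 29 (cell `pub/bsd-2adic`), WANTED-CARRIER-K of the pen's RC-366 (2) / RC-369 (b): the FIRST of the Shapiro maps
(`res`; `cor` and `loc_w` are the next files).  HONEST FRAMING: definitions with bodies and proved theorems only; no named
fact, no `sorry`; nothing about any curve is asserted; BSD is not advanced by this file.

Setting: `κ : ZpExtension ℚ p` with `κ ∘ res : Γ_K → ℤ_p` onto (`h`; for the cyclotomic `κ` and `[K:ℚ]` prime to `p`, or
`p = 2` and `√2 ∉ K`: tree `surjective_comp_absGaloisRestrict_of_not_dvd_finrank` / `…_of_forall_sq_ne_two`), and the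
RESTRICTED `ℤ_p`-extension `κ.restrict K h` of `K` (`ZpExtensionRestrict.lean`: `(κ.restrict K h) σ = κ (res σ)`, the tower
`K·ℚ_∞`; cyclotomic when `κ` is, `isCyclotomic_restrict`).  Keying: `res` is typed for THIS normalisation of `Gal(K_∞/K) ≅ ℤ_p`
(print-exact: a topological generator `γK` of `κ.restrict K h` restricts to the class of `γ`), for which it is `Λ`-LINEAR;
any other cyclotomic normalisation of `K` differs by a unit twist (`ZpExtension.unitTwist`) and `res` becomes semilinear
along the corresponding generator change (cell triage Δ19-2) — not typed here.

* §1 `layerResHom κ h n : Gal(K̄/K_n) →ₜ* Gal(ℚ̄/ℚ_n)` (restriction; `K_n = K·ℚ_n`), `layerResRepHom` (coefficients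
  `T_pW → T_p(W_K)` by `tateModuleEquiv W K p`, equivariant along `res`), **`layerResOver κ h W n : H¹(ℚ_n, T_pW) →
  H¹(K_n, T_pW_K)`** = `ContinuousCohomology.map` of the compatible pair; on cocycles `[φ] ↦ [θ ∘ φ ∘ res]`.
* §2 `layerResOver_conjMap` (equivariance: `res_n (res g · y) = g · res_n y`), `layerResOver_mem_integralH1K`
  (integral classes go to integral classes: `res(I_𝔔) ≤ I_{𝔔 ∩ ℤ̄_ℚ}`, tree `absGaloisRestrict_mem_inertia_comap`),
  `layerResOver_layerCores` (compatible with the trace maps: the transport lemma `map_coresLe_eq_coresLe_map`, the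
  image of `Γ_{K_n}` meeting every coset of `Γ_{ℚ_{n+1}}` in `Γ_{ℚ_n}` because `κ ∘ res` is onto).
* §3 **`IwasawaH1Data.resOver I IK h hγ hγK : I.H →ₗ[Λ] IK.H`** for `I : IwasawaH1Data W p κ γ`,
  `IK : IwasawaH1DataOver (W.baseChange K) p (κ.restrict K h) γK`: the unique map with `IK.proj n (resOver x) =
  layerResOver n (I.proj n x)` (`proj_resOver`, `resOver_unique`); `Λ`-linear because `κ(res γK) = κ γ = 1`.

References: J. Neukirch, A. Schmidt, K. Wingberg, *Cohomology of Number Fields* (2008), I §5 Prop. 1.5.4, (1.5.6)–(1.5.7)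
(res / cor on cochains, compatible pairs) [NeukirchSchmidtWingberg2008]; K. Kato, Astérisque 295 (2004) §8.2, §12.2 [Kato2004Asterisque];
K. Rubin, *Euler Systems* (2000), App. B §3 [Rubin2000]; L. Washington, GTM 83 §13.1 (`K_∞ = Kℚ_∞`) [Washington1997].
-/

noncomputable section

open scoped NumberField Pointwise
open CategoryTheory Field IsDedekindDomain Polynomial
open Literature.NumberTheory.GaloisRepresentations
open Literature.NumberTheory.EllipticCurves (subgroupInclusion subgroupInclusion_apply_coe
  subgroupConj subgroupConj_apply_coe tateModuleEquiv continuous_tateModuleEquiv tateModuleEquiv_tateGaloisRep_restrict)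
open Literature.NumberTheory.EllipticCurves.Kato2004.CM (tateRepK integralH1K mem_integralH1K_iff)
open Literature.NumberTheory.EllipticCurves.Kato2004.EulerSystemValues (tateRep)

namespace Literature.NumberTheory.EllipticCurves.Kato2004

/-! ## §1 The restriction at the `n`-th layer -/

section LayerRes

variable {K : Type} [Field K] [NumberField K] {p : ℕ} [Fact p.Prime] (κ : ZpExtension ℚ p)
  (h : Function.Surjective (κ.toContinuousMonoidHom.comp (absGaloisRestrict ℚ K)))

/-- Membership in the layers of the restricted `ℤ_p`-extension: `σ ∈ Gal(K̄/K_n) ↔ res σ ∈ Gal(ℚ̄/ℚ_n)` (`K_n = K·ℚ_n`).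
[cite: Washington1997, §13.1] -/
theorem mem_layerSubgroup_restrict_iff (n : ℕ) (σ : absoluteGaloisGroup K) :
    σ ∈ (κ.restrict K h).layerSubgroup n ↔ absGaloisRestrict ℚ K σ ∈ κ.layerSubgroup n := by
  rw [ZpExtension.mem_layerSubgroup, ZpExtension.mem_layerSubgroup, ZpExtension.restrict_apply]

/-- The restriction `res_n : Gal(K̄/K_n) →ₜ* Gal(ℚ̄/ℚ_n)` of `Γ_K → Γ_ℚ` (`absGaloisRestrict`).
[cite: NeukirchSchmidtWingberg2008, I §5 Prop. 1.5.4 (compatible pairs)] -/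
def layerResHom (n : ℕ) : (κ.restrict K h).layerSubgroup n →ₜ* κ.layerSubgroup n where
  toFun σ := ⟨absGaloisRestrict ℚ K σ, (mem_layerSubgroup_restrict_iff κ h n σ).mp σ.2⟩
  map_one' := Subtype.ext (map_one _)
  map_mul' _ _ := Subtype.ext (map_mul _ _ _)
  continuous_toFun :=
    ((map_continuous (absGaloisRestrict ℚ K)).comp continuous_subtype_val).subtype_mk _

/-- Unfolding `layerResHom`: `res_n σ = res σ` in `Γ_ℚ`. [cite: NeukirchSchmidtWingberg2008, I §5 Prop. 1.5.4 (compatible pairs)] -/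
@[simp] theorem layerResHom_apply_coe (n : ℕ) (σ : (κ.restrict K h).layerSubgroup n) :
    ((layerResHom κ h n σ : κ.layerSubgroup n) : absoluteGaloisGroup ℚ) = absGaloisRestrict ℚ K σ := rfl

variable (W : WeierstrassCurve ℚ) [W.IsElliptic] [ContinuousSMul ℤ_[p] (W.tateModule p)]
  [ContinuousSMul ℤ_[p] ((W.baseChange K).tateModule p)]

/-- The module half of the compatible pair: `T_pW|_{Γ_{ℚ_n}}` pulled back along `res_n` maps to `T_p(W_K)|_{Γ_{K_n}}` by the
base-change isomorphism `θ_∞ = tateModuleEquiv W K p` (equivariant along `res`, `tateModuleEquiv_tateGaloisRep_restrict`).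
[cite: NeukirchSchmidtWingberg2008, I §5 Prop. 1.5.4] -/
def layerResRepHom (n : ℕ) :
    TopRep.res (layerResHom κ h n : (κ.restrict K h).layerSubgroup n →* κ.layerSubgroup n)
        (subgroupRep (tateRep W p).toTopRep (κ.layerSubgroup n)) ⟶
      subgroupRep (tateRepK (W.baseChange K) p).toTopRep ((κ.restrict K h).layerSubgroup n) :=
  TopRep.ofHom ⟨⟨(tateModuleEquiv W K p).toLinearMap, continuous_tateModuleEquiv W K p⟩, fun σ =>
    ContinuousLinearMap.ext fun v => by
      change tateModuleEquiv W K p ((tateRep W p) (absGaloisRestrict ℚ K (σ : absoluteGaloisGroup K)) v) =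
        (tateRepK (W.baseChange K) p) (σ : absoluteGaloisGroup K) (tateModuleEquiv W K p v)
      have key := tateModuleEquiv_tateGaloisRep_restrict W K p (W.continuous_galoisRepTate_holds p)
        ((W.baseChange K).continuous_galoisRepTate_holds p) (σ : absoluteGaloisGroup K) v
      rwa [ContinuousRep.restrict_apply] at key⟩

/-- The equivariance of `θ_∞` in the currency of the two `TopRep`s: `θ_∞ (T_pW(res g) m) = T_p(W_K)(g) (θ_∞ m)` (the tree's
`tateModuleEquiv_tateGaloisRep_restrict`). [cite: SilvermanAEC2009, III.§7 and VII.§4 (T_ℓ(E) as a module for Gal(K̄_v/K_v) ⊂ Gal(K̄/K))] -/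
theorem tateModuleEquiv_toTopRep_ρ (g : absoluteGaloisGroup K) (m : W.tateModule p) :
    tateModuleEquiv W K p ((tateRep W p).toTopRep.ρ (absGaloisRestrict ℚ K g) m) =
      (tateRepK (W.baseChange K) p).toTopRep.ρ g (tateModuleEquiv W K p m) := by
  rw [ContinuousRep.toTopRep_ρ_apply, ContinuousRep.toTopRep_ρ_apply]
  have key := tateModuleEquiv_tateGaloisRep_restrict W K p (W.continuous_galoisRepTate_holds p)
    ((W.baseChange K).continuous_galoisRepTate_holds p) g m
  rwa [ContinuousRep.restrict_apply] at key

/-- The coefficient map of `res_n` is `θ_∞`. [cite: NeukirchSchmidtWingberg2008, I §5 Prop. 1.5.4 (compatible pairs)] -/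
@[simp] theorem layerResRepHom_hom_apply (n : ℕ) (m : W.tateModule p) :
    (layerResRepHom κ h W n).hom m = tateModuleEquiv W K p m := rfl

/-- **Restriction at the `n`-th layer**: `res_n : H¹(ℚ_n, T_pW) → H¹(K_n, T_pW_K)`, the pull-back along `res_n : Γ_{K_n} → Γ_{ℚ_n}`
with the base-change isomorphism on coefficients. [cite: NeukirchSchmidtWingberg2008, I §5 Prop. 1.5.4] -/
def layerResOver (n : ℕ) :
    H1 (tateRep W p) (κ.layerSubgroup n) ⟶ H1 (tateRepK (W.baseChange K) p) ((κ.restrict K h).layerSubgroup n) :=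
  ContinuousCohomology.map (layerResHom κ h n) (layerResRepHom κ h W n) 1

/-- `res_n` on explicit cocycles: `res_n [φ] = [θ_∞ ∘ φ ∘ res]`. [cite: SerreGaloisCohomology1997, I §2.4] -/
theorem layerResOver_oneCocycleClass (n : ℕ) (φ : contOneCocycles (subgroupRep (tateRep W p).toTopRep (κ.layerSubgroup n))) :
    layerResOver κ h W n (oneCocycleClass _ φ) =
      oneCocycleClass _ (contOneCocycles.pullback (layerResHom κ h n) (layerResRepHom κ h W n) φ) :=
  map_oneCocycleClass _ _ _ φ

/-! ## §2 Equivariance, integrality, compatibility with the trace maps -/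

/-- **`res_n` is `Γ_K`-equivariant**: `res_n (res g · y) = g · res_n y`. [cite: NeukirchSchmidtWingberg2008, I §5 Prop. 1.5.4] -/
theorem layerResOver_conjMap (n : ℕ) (g : absoluteGaloisGroup K) (y : H1 (tateRep W p) (κ.layerSubgroup n)) :
    layerResOver κ h W n (conjMap (tateRep W p).toTopRep (κ.layerSubgroup n) (absGaloisRestrict ℚ K g) 1 y) =
      conjMap (tateRepK (W.baseChange K) p).toTopRep ((κ.restrict K h).layerSubgroup n) g 1 (layerResOver κ h W n y) := by
  obtain ⟨φ, rfl⟩ := oneCocycleClass_surjective _ y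
  rw [conjMap_oneCocycleClass, layerResOver_oneCocycleClass, layerResOver_oneCocycleClass, conjMap_oneCocycleClass]
  refine congrArg _ (Subtype.ext (ContinuousMap.ext fun x => ?_))
  have harg : layerResHom κ h n (subgroupConj ((κ.restrict K h).layerSubgroup n) g x) =
      subgroupConj (κ.layerSubgroup n) (absGaloisRestrict ℚ K g) (layerResHom κ h n x) :=
    Subtype.ext (by simp [subgroupConj_apply_coe, layerResHom_apply_coe, map_mul, map_inv])
  rw [contOneCocycles.pullback_apply, conj_pullback_apply, conj_pullback_apply, contOneCocycles.pullback_apply, harg,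
    layerResRepHom_hom_apply, layerResRepHom_hom_apply]
  exact tateModuleEquiv_toTopRep_ρ W g _

/-- The place of `ℚ` below a finite place `w` of `K` not above `p` is not above `p` (`w ∩ ℤ ∌ p`). [cite: NeukirchANT1999, Ch. I §8 (primes below/above in an extension of Dedekind domains)] -/
theorem primesEquiv_under_ne {w : HeightOneSpectrum (𝓞 K)} (hw : (p : 𝓞 K) ∉ w.asIdeal) :
    ((Rat.HeightOneSpectrum.primesEquiv (HeightOneSpectrum.under (𝓞 ℚ) w) : Nat.Primes) : ℕ) ≠ p := by
  intro hp
  apply hw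
  have hmem : ((p : ℕ) : 𝓞 ℚ) ∈ (HeightOneSpectrum.under (𝓞 ℚ) w).asIdeal := by
    rw [Literature.NumberTheory.EllipticCurves.natCast_mem_asIdeal_iff_eq_primesEquiv_symm _ (Fact.out : p.Prime)]
    apply (Rat.HeightOneSpectrum.primesEquiv).injective
    rw [Equiv.apply_symm_apply]
    exact Subtype.ext hp
  rw [HeightOneSpectrum.under_asIdeal, Ideal.under, Ideal.mem_comap, map_natCast] at hmem
  exact hmem

/-- **`res_n` maps integral classes to integral classes**: `H¹(ℤ_n[1/p], T_pW) → H¹(O_{K_n}[1/p], T_pW_K)` — for a prime `𝔔` of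
`\bar ℤ_K` over `w ∌ p`, `res(Γ_{K_n} ∩ I_𝔔) ≤ Γ_{ℚ_n} ∩ I_{𝔔 ∩ \bar ℤ_ℚ}` (tree `absGaloisRestrict_mem_inertia_comap`) and `𝔔 ∩ \bar ℤ_ℚ`
lies over the place of `ℚ` below `w`, which is `≠ p`; on cocycles a coboundary restricts to a coboundary.
[cite: Kato2004Asterisque, §8.2 and Lemma 8.5 (pp. 180–184)] -/
theorem layerResOver_mem_integralH1K (n : ℕ) {y : H1 (tateRep W p) (κ.layerSubgroup n)}
    (hy : y ∈ integralH1 (tateRep W p) p (κ.layerSubgroup n)) :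
    layerResOver κ h W n y ∈ integralH1K (tateRepK (W.baseChange K) p) p ((κ.restrict K h).layerSubgroup n) := by
  rw [mem_integralH1K_iff]
  intro w hw 𝔔 h𝔔
  obtain ⟨φ, rfl⟩ := oneCocycleClass_surjective _ y
  haveI := h𝔔.1
  -- the prime of `\bar ℤ_ℚ` below `𝔔`, over the place of `ℚ` below `w`
  have h𝔓 : 𝔔.comap (absIntegersMap ℚ K) ∈ (HeightOneSpectrum.under (𝓞 ℚ) w).primesAbove :=
    comap_absIntegersMap_mem_primesAbove (K := ℚ) (M := K) (HeightOneSpectrum.under_asIdeal (𝓞 ℚ) w).symm h𝔔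
  have h0 := (mem_integralH1_iff _ _ _ _).mp hy _ (primesEquiv_under_ne (p := p) hw) _ h𝔓
  rw [resLe_oneCocycleClass, oneCocycleClass_eq_zero_iff] at h0
  obtain ⟨v, hv⟩ := h0
  rw [layerResOver_oneCocycleClass, resLe_oneCocycleClass, oneCocycleClass_eq_zero_iff]
  refine ⟨tateModuleEquiv W K p v, fun σ ↦ ?_⟩
  have hσU : (σ : absoluteGaloisGroup K) ∈ (κ.restrict K h).layerSubgroup n := σ.2.1
  have hσI : absGaloisRestrict ℚ K (σ : absoluteGaloisGroup K) ∈
      (𝔔.comap (absIntegersMap ℚ K)).inertia (absoluteGaloisGroup ℚ) :=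
    absGaloisRestrict_mem_inertia_comap ℚ K σ.2.2
  have key : φ.1 (subgroupInclusion inf_le_left ⟨absGaloisRestrict ℚ K (σ : absoluteGaloisGroup K),
        (mem_layerSubgroup_restrict_iff κ h n _).mp hσU, hσI⟩) =
      (tateRep W p).toTopRep.ρ (absGaloisRestrict ℚ K (σ : absoluteGaloisGroup K)) v - v :=
    hv ⟨absGaloisRestrict ℚ K (σ : absoluteGaloisGroup K), (mem_layerSubgroup_restrict_iff κ h n _).mp hσU, hσI⟩
  rw [contOneCocycles.pullback_apply, TopRep.hom_ofHom]
  change (contOneCocycles.pullback (layerResHom κ h n) (layerResRepHom κ h W n) φ).1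
      (subgroupInclusion (inf_le_left : (κ.restrict K h).layerSubgroup n ⊓
        𝔔.inertia (absoluteGaloisGroup K) ≤ (κ.restrict K h).layerSubgroup n) σ) = _
  have harg : layerResHom κ h n (subgroupInclusion (inf_le_left : (κ.restrict K h).layerSubgroup n ⊓
        𝔔.inertia (absoluteGaloisGroup K) ≤ (κ.restrict K h).layerSubgroup n) σ) =
      subgroupInclusion inf_le_left ⟨absGaloisRestrict ℚ K (σ : absoluteGaloisGroup K),
        (mem_layerSubgroup_restrict_iff κ h n _).mp hσU, hσI⟩ := Subtype.ext rfl
  rw [contOneCocycles.pullback_apply, harg, key, layerResRepHom_hom_apply, map_sub, subgroupRep_ρ_apply,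
    tateModuleEquiv_toTopRep_ρ]

/-- The coset condition: every `g ∈ Γ_{ℚ_n}` is `res(g')` times an element of `Γ_{ℚ_{n+1}}` for some `g' ∈ Γ_{K_n}` (indeed times
an element of `ker κ`), because `κ ∘ res` is onto (`K ∩ ℚ_∞ = ℚ`). [cite: Washington1997, §13.1] -/
theorem exists_layerResHom_inv_mul_mem (n : ℕ) (g : κ.layerSubgroup n) :
    ∃ g' : (κ.restrict K h).layerSubgroup n,
      ((layerResHom κ h n g' : κ.layerSubgroup n) : absoluteGaloisGroup ℚ)⁻¹ * (g : absoluteGaloisGroup ℚ) ∈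
        κ.layerSubgroup (n + 1) := by
  obtain ⟨τ, hτ⟩ := h (κ (g : absoluteGaloisGroup ℚ))
  have hτ' : κ (absGaloisRestrict ℚ K τ) = κ (g : absoluteGaloisGroup ℚ) := hτ
  have hτmem : τ ∈ (κ.restrict K h).layerSubgroup n := by
    rw [mem_layerSubgroup_restrict_iff, ZpExtension.mem_layerSubgroup, hτ']
    exact ZpExtension.mem_layerSubgroup.mp g.2
  refine ⟨⟨τ, hτmem⟩, ?_⟩
  apply κ.kerSubgroup_le_layerSubgroup (n + 1)
  rw [ZpExtension.mem_kerSubgroup, map_mul, map_inv, layerResHom_apply_coe, hτ', inv_mul_cancel]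

/-- `res_{n+1}` and `res_n` agree on `Γ_{K_{n+1}}` (one-sided unfolding on each side: a direct `rfl` would make the kernel compare the
two layers). [folklore] -/
private theorem layerResHom_succ_coe (n : ℕ) (x : (κ.restrict K h).layerSubgroup (n + 1)) :
    ((layerResHom κ h (n + 1) x : κ.layerSubgroup (n + 1)) : absoluteGaloisGroup ℚ) =
      ((layerResHom κ h n ⟨x, (κ.restrict K h).layerSubgroup_antitone (Nat.le_succ n) x.2⟩ : κ.layerSubgroup n) :
        absoluteGaloisGroup ℚ) := by
  rw [layerResHom_apply_coe, layerResHom_apply_coe]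

/-- **Restriction commutes with the trace maps**: `res_n ∘ Cor_{ℚ_{n+1}/ℚ_n} = Cor_{K_{n+1}/K_n} ∘ res_{n+1}` on `H¹(ℚ_{n+1}, T_pW)`
(`[K_{n+1} : K_n] = [ℚ_{n+1} : ℚ_n] = p`, `K_{n+1} = K_n ℚ_{n+1}`; the transport lemma `map_coresLe_eq_coresLe_map`).
[cite: NeukirchSchmidtWingberg2008, I §5 Prop. 1.5.4 and (1.5.6)] -/
theorem layerResOver_layerCores (n : ℕ) (y : H1 (tateRep W p) (κ.layerSubgroup (n + 1))) :
    layerResOver κ h W n (layerCores (tateRep W p) κ n y) =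
      layerCoresOver (tateRepK (W.baseChange K) p) (κ.restrict K h) n (layerResOver κ h W (n + 1) y) := by
  haveI hfi : (κ.layerSubgroup (n + 1)).FiniteIndex :=
    finiteIndex_of_isOpen_of_compactSpace _ (κ.isOpen_layerSubgroup (n + 1))
  haveI hfiK : ((κ.restrict K h).layerSubgroup (n + 1)).FiniteIndex :=
    finiteIndex_of_isOpen_of_compactSpace _ ((κ.restrict K h).isOpen_layerSubgroup (n + 1))
  letI i1 : Fintype (κ.layerSubgroup n ⧸ (κ.layerSubgroup (n + 1)).subgroupOf (κ.layerSubgroup n)) :=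
    Fintype.ofFinite _
  letI i2 : Fintype ((κ.restrict K h).layerSubgroup n ⧸
      ((κ.restrict K h).layerSubgroup (n + 1)).subgroupOf ((κ.restrict K h).layerSubgroup n)) :=
    Fintype.ofFinite _
  have hcos : ∀ g : κ.layerSubgroup n, ∃ g' : (κ.restrict K h).layerSubgroup n,
      (layerResHom κ h n g')⁻¹ * g ∈ (κ.layerSubgroup (n + 1)).subgroupOf (κ.layerSubgroup n) := fun g ↦ by
    obtain ⟨g', hg'⟩ := exists_layerResHom_inv_mul_mem κ h n g
    exact ⟨g', Subgroup.mem_subgroupOf.mpr hg'⟩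
  rw [layerCores_eq_coresLe (tateRep W p) κ n, layerCoresOver_eq_coresLe (tateRepK (W.baseChange K) p) (κ.restrict K h) n]
  exact map_coresLe_eq_coresLe_map (tateRep W p).toTopRep (tateRepK (W.baseChange K) p).toTopRep
    (κ.layerSubgroup_antitone (Nat.le_succ n)) (κ.isOpen_layerSubgroup (n + 1))
    ((κ.restrict K h).layerSubgroup_antitone (Nat.le_succ n)) ((κ.restrict K h).isOpen_layerSubgroup (n + 1))
    (layerResHom κ h n) (layerResHom κ h (n + 1)) (layerResHom_succ_coe κ h n)
    (fun x ↦ by rw [layerResHom_apply_coe]; exact (mem_layerSubgroup_restrict_iff κ h (n + 1) _).symm) hcos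
    (layerResRepHom κ h W n) (layerResRepHom κ h W (n + 1))
    (fun m ↦ by rw [layerResRepHom_hom_apply, layerResRepHom_hom_apply]) y

end LayerRes

/-! ## §3 The restriction `res : 𝐇¹_Γ(T_pW) → 𝐇¹_{K,Γ}(T_pW_K)` on the pinned carriers -/

section Res

variable {K : Type} [Field K] [NumberField K] {p : ℕ} [Fact p.Prime] {κ : ZpExtension ℚ p}
  {h : Function.Surjective (κ.toContinuousMonoidHom.comp (absGaloisRestrict ℚ K))}
  {W : WeierstrassCurve ℚ} [W.IsElliptic] [ContinuousSMul ℤ_[p] (W.tateModule p)]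
  [ContinuousSMul ℤ_[p] ((W.baseChange K).tateModule p)]
  {γ : absoluteGaloisGroup ℚ} {γK : absoluteGaloisGroup K}
  (I : IwasawaH1Data W p κ γ) (IK : IwasawaH1DataOver (W.baseChange K) p (κ.restrict K h) γK)

/-- A linear map intertwining two endomorphisms intertwines the polynomials in them. [folklore] -/
private theorem map_aeval_apply_of_comp_eq_res {N₁ N₂ : Type*} [AddCommGroup N₁] [Module ℤ_[p] N₁]
    [AddCommGroup N₂] [Module ℤ_[p] N₂] (g : N₁ →ₗ[ℤ_[p]] N₂) (a : Module.End ℤ_[p] N₁) (b : Module.End ℤ_[p] N₂)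
    (hg : g ∘ₗ a = b ∘ₗ g) (r : ℤ_[p][X]) (m : N₁) : g (aeval a r m) = aeval b r (g m) := by
  induction r using Polynomial.induction_on generalizing m with
  | C c => simp
  | add f₁ f₂ h₁ h₂ => simp [h₁, h₂]
  | monomial k c hk =>
    have hc : ∀ m, g (a m) = b (g m) := fun m => by simpa using LinearMap.congr_fun hg m
    rw [pow_succ, ← mul_assoc]
    conv_rhs => rw [map_mul, Module.End.mul_apply, aeval_X]
    conv_lhs => rw [map_mul, Module.End.mul_apply, aeval_X]
    rw [hk, hc]

namespace IwasawaH1Data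

/-- The levelwise restrictions of an element of `𝐇¹_Γ(T_pW)`: the family `(res_n (proj n x))_n`. [cite: NeukirchSchmidtWingberg2008, I §5] -/
def resFamily (I : IwasawaH1Data W p κ γ) (h : Function.Surjective (κ.toContinuousMonoidHom.comp (absGaloisRestrict ℚ K)))
    (x : I.H) : ∀ n : ℕ, H1 (tateRepK (W.baseChange K) p) ((κ.restrict K h).layerSubgroup n) :=
  fun n ↦ layerResOver κ h W n (I.proj n x)

/-- Unfolding `resFamily`. [cite: NeukirchSchmidtWingberg2008, I §5 Prop. 1.5.4] -/
@[simp] theorem resFamily_apply (h : Function.Surjective (κ.toContinuousMonoidHom.comp (absGaloisRestrict ℚ K)))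
    (x : I.H) (n : ℕ) : I.resFamily h x n = layerResOver κ h W n (I.proj n x) := rfl

/-- The levelwise restrictions of `x ∈ 𝐇¹_Γ(T_pW)` form a norm-compatible INTEGRAL family over `K`
(`layerResOver_mem_integralH1K`, `layerResOver_layerCores`, `cores_proj`). [cite: Kato2004Asterisque, §12.2 (p. 220)] -/
theorem isNormCompatibleOver_resFamily (h : Function.Surjective (κ.toContinuousMonoidHom.comp (absGaloisRestrict ℚ K)))
    (x : I.H) : IsNormCompatibleOver (tateRepK (W.baseChange K) p) (κ.restrict K h) (I.resFamily h x) :=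
  ⟨fun n ↦ layerResOver_mem_integralH1K κ h W n (I.proj_mem n x),
    fun n ↦ by rw [resFamily_apply, resFamily_apply, ← layerResOver_layerCores, I.cores_proj]⟩

/-- `(res γK)⁻¹ γ ∈ Γ_{ℚ_n}` for all `n` when `γ` and `γK` are topological generators of `κ` and of `κ.restrict K h`
(`κ(res γK) = κ γ = 1`, so the quotient lies in `ker κ`): `conj_γ = conj_{res γK}` on `H¹(ℚ_n, T_pW)`. [cite: Washington1997, §13.1] -/
theorem inv_mul_mem_layerSubgroup_of_isTopGenerator_restrict (hγ : κ.IsTopGenerator γ)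
    (hγK : (κ.restrict K h).IsTopGenerator γK) (n : ℕ) :
    (absGaloisRestrict ℚ K γK)⁻¹ * γ ∈ κ.layerSubgroup n := by
  apply κ.kerSubgroup_le_layerSubgroup n
  have h1 : κ (absGaloisRestrict ℚ K γK) = κ γ := by
    rw [show κ γ = Multiplicative.ofAdd 1 from hγ]; exact hγK
  rw [ZpExtension.mem_kerSubgroup, map_mul, map_inv, h1, inv_mul_cancel]

/-- `res_n` intertwines the LEVEL OPERATORS of the two pins: `res_n ∘ (conj_γ − 1) = (conj_{γK} − 1) ∘ res_n`.
[cite: NeukirchSchmidtWingberg2008, I §5 Prop. 1.5.4] -/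
theorem layerResOver_comp_conj_sub_one (hγ : κ.IsTopGenerator γ) (hγK : (κ.restrict K h).IsTopGenerator γK) (n : ℕ) :
    (layerResOver κ h W n).hom.toLinearMap ∘ₗ
        ((conjMap (tateRep W p).toTopRep (κ.layerSubgroup n) γ 1).hom.toLinearMap - 1) =
      ((conjMap (tateRepK (W.baseChange K) p).toTopRep ((κ.restrict K h).layerSubgroup n) γK 1).hom.toLinearMap - 1) ∘ₗ
        (layerResOver κ h W n).hom.toLinearMap := by
  refine LinearMap.ext fun y ↦ ?_
  simp only [LinearMap.coe_comp, Function.comp_apply, LinearMap.sub_apply, Module.End.one_apply, map_sub]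
  change layerResOver κ h W n (conjMap (tateRep W p).toTopRep (κ.layerSubgroup n) γ 1 y) - _ = _
  rw [conjMap_apply_one_eq_of_inv_mul_mem (tateRep W p).toTopRep (κ.layerSubgroup n)
      (inv_mul_mem_layerSubgroup_of_isTopGenerator_restrict hγ hγK n), layerResOver_conjMap]
  rfl

/-- **The Shapiro restriction `res : 𝐇¹_Γ(T_pW) → 𝐇¹_{K,Γ}(T_pW_K)`** for the pinned `ℚ`-datum `I` and `K`-datum `IK` (tower
`K·ℚ_∞`, keying `κ.restrict K h`), topological generators `γ`, `γK`: the unique map with `IK.proj n (res x) = res_n (I.proj n x)`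
(`proj_resOver`, `resOver_unique`).  `Λ`-LINEAR: additive by construction; compatible with polynomials in `X` because `res_n`
intertwines the level operators (`layerResOver_comp_conj_sub_one`), and with all of `Λ` because both actions are levelwise
through `Λ/(ω_n)` (`IwasawaH1Data.proj_smul`, `IwasawaH1DataOver.proj_smul`). [cite: NeukirchSchmidtWingberg2008, I §5 (1.5.6)–(1.5.7)]
[cite: Rubin2000, App. B §3] -/
def resOver (hγ : κ.IsTopGenerator γ) (hγK : (κ.restrict K h).IsTopGenerator γK) :
    I.H →ₗ[IwasawaAlgebra p] IK.H where
  toFun x := (IK.proj_surjective _ (I.isNormCompatibleOver_resFamily h x)).choose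
  map_add' x x' := IK.proj_eq_iff.mp fun n ↦ by
    rw [map_add, (IK.proj_surjective _ (I.isNormCompatibleOver_resFamily h (x + x'))).choose_spec,
      (IK.proj_surjective _ (I.isNormCompatibleOver_resFamily h x)).choose_spec,
      (IK.proj_surjective _ (I.isNormCompatibleOver_resFamily h x')).choose_spec,
      resFamily_apply, resFamily_apply, resFamily_apply, map_add, map_add]
  map_smul' f x := IK.proj_eq_iff.mp fun n ↦ by
    obtain ⟨r, hr⟩ := IwasawaH1Exists.exists_polynomial_sub_coe_mem_span p n f
    rw [RingHom.id_apply,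
      (IK.proj_surjective _ (I.isNormCompatibleOver_resFamily h (f • x))).choose_spec,
      IK.proj_smul hγK n hr,
      (IK.proj_surjective _ (I.isNormCompatibleOver_resFamily h x)).choose_spec,
      resFamily_apply, resFamily_apply, I.proj_smul hγ n hr]
    exact map_aeval_apply_of_comp_eq_res (layerResOver κ h W n).hom.toLinearMap _ _
      (layerResOver_comp_conj_sub_one hγ hγK n) r (I.proj n x)

/-- **The defining property of `res`**: `IK.proj n (res x) = res_n (I.proj n x)`. [cite: NeukirchSchmidtWingberg2008, I §5] -/
theorem proj_resOver (hγ : κ.IsTopGenerator γ) (hγK : (κ.restrict K h).IsTopGenerator γK) (n : ℕ) (x : I.H) :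
    IK.proj n (I.resOver IK hγ hγK x) = layerResOver κ h W n (I.proj n x) :=
  (IK.proj_surjective _ (I.isNormCompatibleOver_resFamily h x)).choose_spec n

/-- **Uniqueness of `res`**: any map `I.H → IK.H` computed levelwise by the `res_n` IS `resOver` (`IK.proj` is jointly injective).
[cite: Rubin2000, App. B §2–§3 (maps into an inverse limit are determined levelwise)] -/
theorem resOver_unique (hγ : κ.IsTopGenerator γ) (hγK : (κ.restrict K h).IsTopGenerator γK)
    {f : I.H → IK.H} (hf : ∀ (n : ℕ) (x : I.H), IK.proj n (f x) = layerResOver κ h W n (I.proj n x)) :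
    f = I.resOver IK hγ hγK :=
  funext fun x ↦ IK.proj_eq_iff.mp fun n ↦ by rw [hf, proj_resOver]

/-- `res` of the `Λ`-adic class of a norm-compatible integral family `(y_n)_n` over `ℚ` (e.g. Kato's `𝐳`) is the `Λ`-adic class of
the restricted family `(res_n y_n)_n` over `K`. [cite: Rubin2000, App. B §3] -/
theorem proj_resOver_of_proj_eq (hγ : κ.IsTopGenerator γ) (hγK : (κ.restrict K h).IsTopGenerator γK)
    {x : I.H} {y : ∀ n : ℕ, H1 (tateRep W p) (κ.layerSubgroup n)} (hx : ∀ n, I.proj n x = y n) (n : ℕ) :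
    IK.proj n (I.resOver IK hγ hγK x) = layerResOver κ h W n (y n) := by
  rw [proj_resOver, hx]

end IwasawaH1Data

end Res

end Literature.NumberTheory.EllipticCurves.Kato2004

end
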